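import Literature.NumberTheory.Automorphic.UnitOrbitalIntegralFixedPoints            -- ★ p839788 F0P3a-p04 (g12) «N7-inert-L2»: `classOrbitalIntegral_indicator_eq_card_fixedBy` (the L2 class reading of record)
import Literature.NumberTheory.Automorphic.UnitaryResiduallyRegularOrbitalIntegral  -- ★ A-p01: `orbitalIntegral_indicator_complex_eq_ofReal`, `isCompact_isOpen_cmLocalIntegralLevel_prod`; instances on `(cmDatum L N H).Local v`
import Literature.NumberTheory.Automorphic.LocalRegularOrbitClosed                  -- ★ `isClosed_conjClass_local_of_isRegularElt`
import Literature.NumberTheory.Automorphic.LocalEndoscopicOrbitClosed               -- ★ `isClosed_conjClass_localH_of_isLocalGRegular`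
import Literature.NumberTheory.Rogawski1990.GRegularLocalisation                    -- ★ `isLocalGRegular_of_isConj`
import HarnessLib

/-!
# The unit orbital integrals of `U(H)(L⁺_v)` and of `H_v = U(Φ₂)(L⁺_v) × U(Φ₁)(L⁺_v)` at a regular class with COMPACT centraliser are fixed-point counts:
# `Φ([γ], 1_{K_v}; m) = #Fix_γ(U(H)(L⁺_v) ⧸ K_v)` — the two SOCKETS of the inert unit fundamental lemma (L2 dress)
(Rogawski (1990), §4.9 Prop. 4.9.1 (b) p. 55 at a non-split place: both sides of «`Δ_{G∕H}(γ)Φ^κ(γ, 1_K) = Φ^st(γ, 1_{K_H})`» are weighted counts of `γ`-fixed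
hyperspecial vertices; Laumon (1996) Lemma (5.3.2); Kottwitz (1986) §3)

Topic `NumberTheory/Automorphic`; namespace `Literature.NumberTheory.Automorphic.UnitaryGroup`.  THEOREMS ONLY (no definition, no instance, no notation, no named fact,
no `sorry`).  Cell `pub/hodgecm-mathlib`, crux H413 = stmt-HodgeConjecture-24833, road N7 #103 non-split half (A-p06 map «D-N7-inert» 84809157 §3 (L2)); LEAD F0P3a-plan
(g9) WORD T8-16 (B)(3) «L2 INERT ELLIPTIC DRESS»; seat F0P3-p01 (g12).  HONEST LABEL: HC_CM is proved only modulo the printed citations until rung 0 closes; nothing printed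
is asserted — this file DRESSES the generic L2 class reading (★ `classOrbitalIntegral_indicator_eq_card_fixedBy`: canonical family, compact centraliser, closed class, `ν(K) = 1`
⇒ `Φ([γ], 1_K) = #Fix_γ(G ⧸ K)`) on the two carriers of the letter ★ `IsLocalUnitTransfer` (`G′_v = U(H′)(L⁺_v)` with `K′_v = ★ cmLocalIntegralLevel`, regularity
`IsRegularElt`; `H_v` with `K_{H,v} = K₂ ×ˢ K₁`, regularity ★ `IsLocalGRegular`), discharging the closed-class and compact-open-level hypotheses by name (★
`isClosed_conjClass_local_of_isRegularElt`, ★ `isClosed_conjClass_localH_of_isLocalGRegular`, ★ `isCompact_isOpen_cmLocalIntegralLevel(_prod)`) and reading the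
letter's `ℂ`-valued unit (★ `orbitalIntegral_indicator_complex_eq_ofReal`).  The COMPACTNESS of the centraliser (ellipticity: torus types `(E¹_w)³`, `E¹_w × L¹` at an
inert `v`) stays a BINDER `[CompactSpace ↥(Subgroup.centralizer {γ})]` — its discharge is the local-class-set road (L4a), not this file.  These are the two numbers the
held count (L3)∕(L5)∕(L7) equates: `Σ_x κ(x) · #Fix_{γ_x}(G′_v ⧸ K′_v)` against `#Fix_{γ_H}(H_v ⧸ K_{H,v})`.

* §1 `classOrbitalIntegral_indicator_complex_eq_ofReal` (generic: the class form of ★ `orbitalIntegral_indicator_complex_eq_ofReal`),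
  `classOrbitalIntegral_indicator_complex_eq_natCard_fixedBy` (generic `ℂ` twin of ★ p04's class reading).
* §2 **`classOrbitalIntegral_indicator_cmLocalIntegralLevel_eq_natCard_fixedBy`** (+ `_complex_`) — the `G′_v` socket, every rank `N`, every hermitian `H` with
  `det H ≠ 0`, every finite `v`.
* §3 **`classOrbitalIntegral_indicator_cmLocalIntegralLevel_prod_eq_natCard_fixedBy`** (+ `_complex_`) — the `H_v` socket at a `G`-regular `γ_H`.

## References
* [Rogawski1990] J. D. Rogawski, *Automorphic Representations of Unitary Groups in Three Variables*, Ann. of Math. Stud. 123 (1990): §4.9 p. 54, Prop. 4.9.1 (b) p. 55;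
  §4.3 (4.3.1) p. 43.
* [Laumon1995] G. Laumon, *Cohomology of Drinfeld Modular Varieties* I (1996): Lemma (5.3.2) p. 136.
* [Kottwitz1986] R. E. Kottwitz, *Base change for unit elements of Hecke algebras*, Compositio Math. 60 (1986): §3.
-/

set_option autoImplicit false

noncomputable section

open MeasureTheory Measure Topology Set Filter Function NumberField IsDedekindDomain
open Literature.NumberTheory.Rogawski1990
open scoped ENNReal NNReal Matrix MatrixGroups

namespace Literature.NumberTheory.Automorphic

/-! ## §1 Generic: the `ℂ`-valued class reading -/

section Generic

variable {G : Type*} [Group G] [TopologicalSpace G] [IsTopologicalGroup G] [LocallyCompactSpace G] [SecondCountableTopology G] [T2Space G]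
  [MeasurableSpace G] [BorelSpace G]
  [∀ γ : G, MeasurableSpace (G ⧸ Subgroup.centralizer ({γ} : Set G))] [∀ γ : G, BorelSpace (G ⧸ Subgroup.centralizer ({γ} : Set G))]

omit [TopologicalSpace G] [IsTopologicalGroup G] [LocallyCompactSpace G] [SecondCountableTopology G] [T2Space G] [MeasurableSpace G] [BorelSpace G]
  [∀ γ : G, BorelSpace (G ⧸ Subgroup.centralizer ({γ} : Set G))] in
/-- The `ℂ`-valued unit class orbital integral is the `ℝ`-valued one (★ `orbitalIntegral_indicator_complex_eq_ofReal` at the representative). [cite: Rogawski1990, §4.9 p. 54] -/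
theorem classOrbitalIntegral_indicator_complex_eq_ofReal (m : OrbitalMeasureFamily G) (K : Subgroup G) (c : ConjClasses G) :
    classOrbitalIntegral m ((K : Set G).indicator fun _ => (1 : ℂ)) c = ((classOrbitalIntegral m ((K : Set G).indicator (1 : G → ℝ)) c : ℝ) : ℂ) := by
  rw [classOrbitalIntegral_eq, classOrbitalIntegral_eq, orbitalIntegral_indicator_complex_eq_ofReal]

/-- **`Φ([γ], 1_K; m) = #Fix_γ(G ⧸ K)` in the letters' `ℂ` currency** — ★ `classOrbitalIntegral_indicator_eq_card_fixedBy` (F0P3a-p04: `m` canonical for `(P, ν)`, `P`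
conjugation-invariant with `P γ`, `ν(K) = 1`, `C_G(γ)` COMPACT, the class of `γ` closed, `K` compact open) read on `1_K : G → ℂ`.
[cite: Rogawski1990, §4.9 Prop. 4.9.1 (b) p. 55] [cite: Laumon1995, Lemma (5.3.2) p. 136] -/
theorem classOrbitalIntegral_indicator_complex_eq_natCard_fixedBy {P : G → Prop} (hP : ∀ g x : G, P g → P (x * g * x⁻¹))
    {ν : Measure G} [ν.IsHaarMeasure] [ν.IsMulRightInvariant] {m : OrbitalMeasureFamily G} (hm : m.IsCanonical P ν)
    {γ : G} (hγ : P γ) [CompactSpace (Subgroup.centralizer ({γ} : Set G))] (K : Subgroup G) (hK : IsOpen (K : Set G))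
    (hKc : IsCompact (K : Set G)) (hν : ν K = 1) (hO : IsClosed {g | ∃ y : G, y * γ * y⁻¹ = g}) :
    classOrbitalIntegral m ((K : Set G).indicator fun _ => (1 : ℂ)) (ConjClasses.mk γ) = (Nat.card (MulAction.fixedBy (G ⧸ K) γ) : ℂ) := by
  rw [classOrbitalIntegral_indicator_complex_eq_ofReal, classOrbitalIntegral_indicator_eq_card_fixedBy hP hm hγ K hK hKc hν hO, Complex.ofReal_natCast]

end Generic

namespace UnitaryGroup

/-! ## §2 The `G′_v`-socket: `U(H)(L⁺_v)`, `K_v = U(H)(𝒪_v)`, regularity `IsRegularElt` -/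

section G

variable (L : Type) [Field L] [NumberField L] [IsCMField L] (N : ℕ) (H : Matrix (Fin N) (Fin N) L) (v : HeightOneSpectrum (𝓞 ↥(maximalRealSubfield L)))
  [MeasurableSpace ((cmDatum L N H).Local v)] [BorelSpace ((cmDatum L N H).Local v)]
  [∀ γ : (cmDatum L N H).Local v, MeasurableSpace ((cmDatum L N H).Local v ⧸ Subgroup.centralizer ({γ} : Set ((cmDatum L N H).Local v)))]
  [∀ γ : (cmDatum L N H).Local v, BorelSpace ((cmDatum L N H).Local v ⧸ Subgroup.centralizer ({γ} : Set ((cmDatum L N H).Local v)))]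
  (ν : Measure ((cmDatum L N H).Local v)) [IsHaarMeasure ν] [ν.IsMulRightInvariant]

omit [MeasurableSpace ((cmDatum L N H).Local v)] [BorelSpace ((cmDatum L N H).Local v)]
  [∀ γ : (cmDatum L N H).Local v, MeasurableSpace ((cmDatum L N H).Local v ⧸ Subgroup.centralizer ({γ} : Set ((cmDatum L N H).Local v)))]
  [∀ γ : (cmDatum L N H).Local v, BorelSpace ((cmDatum L N H).Local v ⧸ Subgroup.centralizer ({γ} : Set ((cmDatum L N H).Local v)))] in
/-- Regularity of `γ.val ∈ GL_N` is a class function on `U(H)(L⁺_v)` (★ `isRegularElt_conj_iff`). [cite: Rogawski1990, §3.1 p. 19] -/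
theorem isRegularElt_val_conj (g x : (cmDatum L N H).Local v) (hg : IsRegularElt (g.val : GL (Fin N) (LocalRing L v))) :
    IsRegularElt ((x * g * x⁻¹ : (cmDatum L N H).Local v).val : GL (Fin N) (LocalRing L v)) := by
  exact (isRegularElt_conj_iff (x.val : GL (Fin N) (LocalRing L v)) (g.val : GL (Fin N) (LocalRing L v))).2 hg

/-- **THE `G′_v` SOCKET — `Φ([γ], 1_{U(H)(𝒪_v)}; m) = #Fix_γ(U(H)(L⁺_v) ⧸ U(H)(𝒪_v))`** for `m` CANONICAL for `(IsRegularElt, ν)` (★ `OrbitalMeasureFamily.IsCanonical`: at every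
regular class the invariant quotient of `ν` by the inversion-invariant Haar measure of mass one on the compact core of the centraliser), `ν(U(H)(𝒪_v)) = 1`, `γ` REGULAR
semisimple with COMPACT centraliser (the elliptic case; at an inert `v` and `N = 3`: torus `(E¹_w)³` or `E¹_w × L¹`) — every rank `N`, every hermitian `H` with `det H ≠ 0`,
every finite place `v` of `L⁺`.  The class of `γ` is closed (★ `isClosed_conjClass_local_of_isRegularElt`), `U(H)(𝒪_v)` is compact open (★
`isCompact_isOpen_cmLocalIntegralLevel`), so ★ `classOrbitalIntegral_indicator_eq_card_fixedBy` applies. [cite: Rogawski1990, §4.9 Prop. 4.9.1 (b) p. 55; §4.3 (4.3.1) p. 43]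
[cite: Laumon1995, Lemma (5.3.2) p. 136] [cite: Kottwitz1986, §3] -/
theorem classOrbitalIntegral_indicator_cmLocalIntegralLevel_eq_natCard_fixedBy (hH : (H.map (cmConjRingHom L))ᵀ = H) (hdet : H.det ≠ 0)
    {m : OrbitalMeasureFamily ((cmDatum L N H).Local v)} (hm : m.IsCanonical (fun γ => IsRegularElt (γ.val : GL (Fin N) (LocalRing L v))) ν)
    (hν : ν (cmLocalIntegralLevel L N H v : Set ((cmDatum L N H).Local v)) = 1)
    (γ : (cmDatum L N H).Local v) (hreg : IsRegularElt (γ.val : GL (Fin N) (LocalRing L v)))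
    [CompactSpace (Subgroup.centralizer ({γ} : Set ((cmDatum L N H).Local v)))] :
    classOrbitalIntegral m ((cmLocalIntegralLevel L N H v : Set ((cmDatum L N H).Local v)).indicator (1 : (cmDatum L N H).Local v → ℝ)) (ConjClasses.mk γ) =
      (Nat.card (MulAction.fixedBy ((cmDatum L N H).Local v ⧸ cmLocalIntegralLevel L N H v) γ) : ℝ) :=
  classOrbitalIntegral_indicator_eq_card_fixedBy (P := fun γ : (cmDatum L N H).Local v => IsRegularElt (γ.val : GL (Fin N) (LocalRing L v)))
    (fun g x hg => isRegularElt_val_conj L N H v g x hg) hm hreg (cmLocalIntegralLevel L N H v)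
    (isCompact_isOpen_cmLocalIntegralLevel L N H v).2 (isCompact_isOpen_cmLocalIntegralLevel L N H v).1 hν
    (isClosed_conjClass_local_of_isRegularElt L N H v hH hdet γ hreg)

/-- **The `G′_v` socket in the letter's `ℂ` currency**: `classOrbitalIntegral m ((U(H)(𝒪_v)).indicator fun _ => (1 : ℂ)) ⟦γ⟧ = #Fix_γ` — the `G`-side summand of ★
`IsLocalUnitTransfer` at an elliptic regular class. [cite: Rogawski1990, §4.9 Prop. 4.9.1 (b) p. 55] [cite: Laumon1995, Lemma (5.3.2) p. 136] -/
theorem classOrbitalIntegral_indicator_complex_cmLocalIntegralLevel_eq_natCard_fixedBy (hH : (H.map (cmConjRingHom L))ᵀ = H) (hdet : H.det ≠ 0)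
    {m : OrbitalMeasureFamily ((cmDatum L N H).Local v)} (hm : m.IsCanonical (fun γ => IsRegularElt (γ.val : GL (Fin N) (LocalRing L v))) ν)
    (hν : ν (cmLocalIntegralLevel L N H v : Set ((cmDatum L N H).Local v)) = 1)
    (γ : (cmDatum L N H).Local v) (hreg : IsRegularElt (γ.val : GL (Fin N) (LocalRing L v)))
    [CompactSpace (Subgroup.centralizer ({γ} : Set ((cmDatum L N H).Local v)))] :
    classOrbitalIntegral m ((cmLocalIntegralLevel L N H v : Set ((cmDatum L N H).Local v)).indicator fun _ => (1 : ℂ)) (ConjClasses.mk γ) =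
      (Nat.card (MulAction.fixedBy ((cmDatum L N H).Local v ⧸ cmLocalIntegralLevel L N H v) γ) : ℂ) := by
  rw [classOrbitalIntegral_indicator_complex_eq_ofReal,
    classOrbitalIntegral_indicator_cmLocalIntegralLevel_eq_natCard_fixedBy L N H v ν hH hdet hm hν γ hreg, Complex.ofReal_natCast]

end G

/-! ## §3 The `H_v`-socket: `U(Φ₂)(L⁺_v) × U(Φ₁)(L⁺_v)`, `K_{H,v} = U(Φ₂)(𝒪_v) ×ˢ U(Φ₁)(𝒪_v)`, regularity `IsLocalGRegular` -/

section H

variable (L : Type) [Field L] [NumberField L] [IsCMField L] (v : HeightOneSpectrum (𝓞 ↥(maximalRealSubfield L)))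
  [MeasurableSpace ((cmDatum L 2 (Matrix.of fun i j : Fin 2 => if i.val + j.val + 1 = 2 then (1 : L) else 0)).Local v × (cmDatum L 1 (Matrix.of fun i j : Fin 1 => if i.val + j.val + 1 = 1 then (1 : L) else 0)).Local v)]
  [BorelSpace ((cmDatum L 2 (Matrix.of fun i j : Fin 2 => if i.val + j.val + 1 = 2 then (1 : L) else 0)).Local v × (cmDatum L 1 (Matrix.of fun i j : Fin 1 => if i.val + j.val + 1 = 1 then (1 : L) else 0)).Local v)]
  [∀ a : (cmDatum L 2 (Matrix.of fun i j : Fin 2 => if i.val + j.val + 1 = 2 then (1 : L) else 0)).Local v × (cmDatum L 1 (Matrix.of fun i j : Fin 1 => if i.val + j.val + 1 = 1 then (1 : L) else 0)).Local v,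
    MeasurableSpace (((cmDatum L 2 (Matrix.of fun i j : Fin 2 => if i.val + j.val + 1 = 2 then (1 : L) else 0)).Local v × (cmDatum L 1 (Matrix.of fun i j : Fin 1 => if i.val + j.val + 1 = 1 then (1 : L) else 0)).Local v) ⧸
      Subgroup.centralizer ({a} : Set ((cmDatum L 2 (Matrix.of fun i j : Fin 2 => if i.val + j.val + 1 = 2 then (1 : L) else 0)).Local v × (cmDatum L 1 (Matrix.of fun i j : Fin 1 => if i.val + j.val + 1 = 1 then (1 : L) else 0)).Local v)))]
  [∀ a : (cmDatum L 2 (Matrix.of fun i j : Fin 2 => if i.val + j.val + 1 = 2 then (1 : L) else 0)).Local v × (cmDatum L 1 (Matrix.of fun i j : Fin 1 => if i.val + j.val + 1 = 1 then (1 : L) else 0)).Local v,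
    BorelSpace (((cmDatum L 2 (Matrix.of fun i j : Fin 2 => if i.val + j.val + 1 = 2 then (1 : L) else 0)).Local v × (cmDatum L 1 (Matrix.of fun i j : Fin 1 => if i.val + j.val + 1 = 1 then (1 : L) else 0)).Local v) ⧸
      Subgroup.centralizer ({a} : Set ((cmDatum L 2 (Matrix.of fun i j : Fin 2 => if i.val + j.val + 1 = 2 then (1 : L) else 0)).Local v × (cmDatum L 1 (Matrix.of fun i j : Fin 1 => if i.val + j.val + 1 = 1 then (1 : L) else 0)).Local v)))]
  (νH : Measure ((cmDatum L 2 (Matrix.of fun i j : Fin 2 => if i.val + j.val + 1 = 2 then (1 : L) else 0)).Local v × (cmDatum L 1 (Matrix.of fun i j : Fin 1 => if i.val + j.val + 1 = 1 then (1 : L) else 0)).Local v)) [IsHaarMeasure νH] [νH.IsMulRightInvariant]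

/-- **THE `H_v` SOCKET — `Φ([γ_H], 1_{K_{H,v}}; m_H) = #Fix_{γ_H}(H_v ⧸ K_{H,v})`** for `m_H` CANONICAL for `(IsLocalGRegular, ν_H)`, `ν_H(K_{H,v}) = 1`, `γ_H` `G`-REGULAR (★
`IsLocalGRegular`, a class function ★ `isLocalGRegular_of_isConj`; closed class ★ `isClosed_conjClass_localH_of_isLocalGRegular`) with COMPACT centraliser, `K_{H,v} = U(Φ₂)(𝒪_v) ×ˢ
U(Φ₁)(𝒪_v)` (compact open ★ `isCompact_isOpen_cmLocalIntegralLevel_prod`). [cite: Rogawski1990, §4.9 Prop. 4.9.1 (b) p. 55; §4.3 (4.3.1) p. 43] [cite: Laumon1995, Lemma (5.3.2) p. 136]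
[cite: Kottwitz1986, §3] -/
theorem classOrbitalIntegral_indicator_cmLocalIntegralLevel_prod_eq_natCard_fixedBy
    {mH : OrbitalMeasureFamily ((cmDatum L 2 (Matrix.of fun i j : Fin 2 => if i.val + j.val + 1 = 2 then (1 : L) else 0)).Local v × (cmDatum L 1 (Matrix.of fun i j : Fin 1 => if i.val + j.val + 1 = 1 then (1 : L) else 0)).Local v)} (hmH : mH.IsCanonical (IsLocalGRegular L v) νH)
    (hνH : νH (((cmLocalIntegralLevel L 2 (Matrix.of fun i j : Fin 2 => if i.val + j.val + 1 = 2 then (1 : L) else 0) v).prod (cmLocalIntegralLevel L 1 (Matrix.of fun i j : Fin 1 => if i.val + j.val + 1 = 1 then (1 : L) else 0) v) :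
        Subgroup ((cmDatum L 2 (Matrix.of fun i j : Fin 2 => if i.val + j.val + 1 = 2 then (1 : L) else 0)).Local v × (cmDatum L 1 (Matrix.of fun i j : Fin 1 => if i.val + j.val + 1 = 1 then (1 : L) else 0)).Local v)) : Set ((cmDatum L 2 (Matrix.of fun i j : Fin 2 => if i.val + j.val + 1 = 2 then (1 : L) else 0)).Local v × (cmDatum L 1 (Matrix.of fun i j : Fin 1 => if i.val + j.val + 1 = 1 then (1 : L) else 0)).Local v)) = 1)
    (γH : (cmDatum L 2 (Matrix.of fun i j : Fin 2 => if i.val + j.val + 1 = 2 then (1 : L) else 0)).Local v × (cmDatum L 1 (Matrix.of fun i j : Fin 1 => if i.val + j.val + 1 = 1 then (1 : L) else 0)).Local v) (hγ : IsLocalGRegular L v γH)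
    [CompactSpace (Subgroup.centralizer ({γH} : Set ((cmDatum L 2 (Matrix.of fun i j : Fin 2 => if i.val + j.val + 1 = 2 then (1 : L) else 0)).Local v × (cmDatum L 1 (Matrix.of fun i j : Fin 1 => if i.val + j.val + 1 = 1 then (1 : L) else 0)).Local v)))] :
    classOrbitalIntegral mH ((((cmLocalIntegralLevel L 2 (Matrix.of fun i j : Fin 2 => if i.val + j.val + 1 = 2 then (1 : L) else 0) v).prod (cmLocalIntegralLevel L 1 (Matrix.of fun i j : Fin 1 => if i.val + j.val + 1 = 1 then (1 : L) else 0) v) :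
        Subgroup ((cmDatum L 2 (Matrix.of fun i j : Fin 2 => if i.val + j.val + 1 = 2 then (1 : L) else 0)).Local v × (cmDatum L 1 (Matrix.of fun i j : Fin 1 => if i.val + j.val + 1 = 1 then (1 : L) else 0)).Local v)) : Set ((cmDatum L 2 (Matrix.of fun i j : Fin 2 => if i.val + j.val + 1 = 2 then (1 : L) else 0)).Local v × (cmDatum L 1 (Matrix.of fun i j : Fin 1 => if i.val + j.val + 1 = 1 then (1 : L) else 0)).Local v)).indicator (1 : (cmDatum L 2 (Matrix.of fun i j : Fin 2 => if i.val + j.val + 1 = 2 then (1 : L) else 0)).Local v × (cmDatum L 1 (Matrix.of fun i j : Fin 1 => if i.val + j.val + 1 = 1 then (1 : L) else 0)).Local v → ℝ)) (ConjClasses.mk γH) =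
      (Nat.card (MulAction.fixedBy (((cmDatum L 2 (Matrix.of fun i j : Fin 2 => if i.val + j.val + 1 = 2 then (1 : L) else 0)).Local v × (cmDatum L 1 (Matrix.of fun i j : Fin 1 => if i.val + j.val + 1 = 1 then (1 : L) else 0)).Local v) ⧸
        ((cmLocalIntegralLevel L 2 (Matrix.of fun i j : Fin 2 => if i.val + j.val + 1 = 2 then (1 : L) else 0) v).prod (cmLocalIntegralLevel L 1 (Matrix.of fun i j : Fin 1 => if i.val + j.val + 1 = 1 then (1 : L) else 0) v) :
        Subgroup ((cmDatum L 2 (Matrix.of fun i j : Fin 2 => if i.val + j.val + 1 = 2 then (1 : L) else 0)).Local v × (cmDatum L 1 (Matrix.of fun i j : Fin 1 => if i.val + j.val + 1 = 1 then (1 : L) else 0)).Local v))) γH) : ℝ) :=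
  classOrbitalIntegral_indicator_eq_card_fixedBy (P := IsLocalGRegular L v)
    (fun _ x hg => isLocalGRegular_of_isConj (isConj_iff.2 ⟨x, rfl⟩) hg) hmH hγ _
    (isCompact_isOpen_cmLocalIntegralLevel_prod L 2 1 (Matrix.of fun i j : Fin 2 => if i.val + j.val + 1 = 2 then (1 : L) else 0) (Matrix.of fun i j : Fin 1 => if i.val + j.val + 1 = 1 then (1 : L) else 0) v).2 (isCompact_isOpen_cmLocalIntegralLevel_prod L 2 1 (Matrix.of fun i j : Fin 2 => if i.val + j.val + 1 = 2 then (1 : L) else 0) (Matrix.of fun i j : Fin 1 => if i.val + j.val + 1 = 1 then (1 : L) else 0) v).1 hνH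
    (isClosed_conjClass_localH_of_isLocalGRegular L v γH hγ)

/-- **The `H_v` socket in the letter's `ℂ` currency**: `classOrbitalIntegral m_H (K_{H,v}.indicator fun _ => (1 : ℂ)) ⟦γ_H⟧ = #Fix_{γ_H}` — the `H`-side term `Φ^st(γ_H, 1_{K_H})`'s
summand in ★ `IsLocalUnitTransfer` at an elliptic `G`-regular class. [cite: Rogawski1990, §4.9 Prop. 4.9.1 (b) p. 55] [cite: Laumon1995, Lemma (5.3.2) p. 136] -/
theorem classOrbitalIntegral_indicator_complex_cmLocalIntegralLevel_prod_eq_natCard_fixedBy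
    {mH : OrbitalMeasureFamily ((cmDatum L 2 (Matrix.of fun i j : Fin 2 => if i.val + j.val + 1 = 2 then (1 : L) else 0)).Local v × (cmDatum L 1 (Matrix.of fun i j : Fin 1 => if i.val + j.val + 1 = 1 then (1 : L) else 0)).Local v)} (hmH : mH.IsCanonical (IsLocalGRegular L v) νH)
    (hνH : νH (((cmLocalIntegralLevel L 2 (Matrix.of fun i j : Fin 2 => if i.val + j.val + 1 = 2 then (1 : L) else 0) v).prod (cmLocalIntegralLevel L 1 (Matrix.of fun i j : Fin 1 => if i.val + j.val + 1 = 1 then (1 : L) else 0) v) :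
        Subgroup ((cmDatum L 2 (Matrix.of fun i j : Fin 2 => if i.val + j.val + 1 = 2 then (1 : L) else 0)).Local v × (cmDatum L 1 (Matrix.of fun i j : Fin 1 => if i.val + j.val + 1 = 1 then (1 : L) else 0)).Local v)) : Set ((cmDatum L 2 (Matrix.of fun i j : Fin 2 => if i.val + j.val + 1 = 2 then (1 : L) else 0)).Local v × (cmDatum L 1 (Matrix.of fun i j : Fin 1 => if i.val + j.val + 1 = 1 then (1 : L) else 0)).Local v)) = 1)
    (γH : (cmDatum L 2 (Matrix.of fun i j : Fin 2 => if i.val + j.val + 1 = 2 then (1 : L) else 0)).Local v × (cmDatum L 1 (Matrix.of fun i j : Fin 1 => if i.val + j.val + 1 = 1 then (1 : L) else 0)).Local v) (hγ : IsLocalGRegular L v γH)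
    [CompactSpace (Subgroup.centralizer ({γH} : Set ((cmDatum L 2 (Matrix.of fun i j : Fin 2 => if i.val + j.val + 1 = 2 then (1 : L) else 0)).Local v × (cmDatum L 1 (Matrix.of fun i j : Fin 1 => if i.val + j.val + 1 = 1 then (1 : L) else 0)).Local v)))] :
    classOrbitalIntegral mH ((((cmLocalIntegralLevel L 2 (Matrix.of fun i j : Fin 2 => if i.val + j.val + 1 = 2 then (1 : L) else 0) v).prod (cmLocalIntegralLevel L 1 (Matrix.of fun i j : Fin 1 => if i.val + j.val + 1 = 1 then (1 : L) else 0) v) :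
        Subgroup ((cmDatum L 2 (Matrix.of fun i j : Fin 2 => if i.val + j.val + 1 = 2 then (1 : L) else 0)).Local v × (cmDatum L 1 (Matrix.of fun i j : Fin 1 => if i.val + j.val + 1 = 1 then (1 : L) else 0)).Local v)) : Set ((cmDatum L 2 (Matrix.of fun i j : Fin 2 => if i.val + j.val + 1 = 2 then (1 : L) else 0)).Local v × (cmDatum L 1 (Matrix.of fun i j : Fin 1 => if i.val + j.val + 1 = 1 then (1 : L) else 0)).Local v)).indicator fun _ => (1 : ℂ)) (ConjClasses.mk γH) =
      (Nat.card (MulAction.fixedBy (((cmDatum L 2 (Matrix.of fun i j : Fin 2 => if i.val + j.val + 1 = 2 then (1 : L) else 0)).Local v × (cmDatum L 1 (Matrix.of fun i j : Fin 1 => if i.val + j.val + 1 = 1 then (1 : L) else 0)).Local v) ⧸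
        ((cmLocalIntegralLevel L 2 (Matrix.of fun i j : Fin 2 => if i.val + j.val + 1 = 2 then (1 : L) else 0) v).prod (cmLocalIntegralLevel L 1 (Matrix.of fun i j : Fin 1 => if i.val + j.val + 1 = 1 then (1 : L) else 0) v) :
        Subgroup ((cmDatum L 2 (Matrix.of fun i j : Fin 2 => if i.val + j.val + 1 = 2 then (1 : L) else 0)).Local v × (cmDatum L 1 (Matrix.of fun i j : Fin 1 => if i.val + j.val + 1 = 1 then (1 : L) else 0)).Local v))) γH) : ℂ) := by
  rw [classOrbitalIntegral_indicator_complex_eq_ofReal,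
    classOrbitalIntegral_indicator_cmLocalIntegralLevel_prod_eq_natCard_fixedBy L v νH hmH hνH γH hγ, Complex.ofReal_natCast]

end H

end UnitaryGroup

end Literature.NumberTheory.Automorphic

end
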